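import Literature.Analysis.FluidPDE.HelmholtzAnnihilator
import Literature.Analysis.FluidPDE.RieszPressureLocality
import Literature.Analysis.FluidPDE.ClassicalDriftNSLocalEnergy
import Literature.Analysis.FluidPDE.PressurePoisson
import Literature.Analysis.FluidPDE.DistributionalPressurePoisson
import HarnessLib

/-!
# The classical pressure of the drift system is the Riesz pressure of the pair `(w, u)`

Analysis/FluidPDE proof file (theorems only). Third brick of the proof that Leray's regularised
scheme converges to a suitable weak solution (Leray 1934, Ch. V; Caffarelli–Kohn–Nirenberg 1982, §2
and Appendix). To pass to the limit in the pressure term `∫∫ 2p u·∇φ` of the local energy equality of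
the regularised solutions one needs `L^{3/2}` control of the classical pressures `p_ε` of Leray's
drift system `∂ₜu + (w·∇)u = νΔu − ∇p`, `div u = div w = 0` (`w = J_ε u`), whereas the Fourier-side
construction of the tree only records `p_ε(t) ∈ L²`. This file identifies `p_ε(t)`, for every interior
time, with the **Riesz pressure of the pair** `(w(t), u(t))`,

  `Π[w, u] := ¼ (Π[w + u] − Π[w − u]) = Σᵢⱼ ℛᵢℛⱼ(wᵢuⱼ)`,

the polarisation of the tree's quadratic Riesz pressure `Π[v] = Σᵢⱼ ℛᵢℛⱼ(vᵢvⱼ)` (`rieszPressure`,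
`RieszPressureL3.lean`; Lemarié-Rieusset 2016, Def. 6.9 with Prop. 6.2; Tsai 1998, Lemma 2.1), so that
Stein's bound `‖Π[v]‖_{3/2} ≤ C ‖v‖₃²` and the `L³ → L^{3/2}` continuity of `Π` become available for
`p_ε`. The identification is Liouville's theorem: both `p_ε(t) ∈ L²` and `Π[w, u](t) ∈ L^{3/2}` solve
the weak Poisson equation `∫ q Δθ = −∫ D²θ(w, u)` (`θ ∈ C_c^∞`), so their difference is a weakly
harmonic function in `L² + L^{3/2}`, hence zero (Lemarié-Rieusset 2016, proof of Thm. 4.4, pp. 56–57;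
the tree's `HarmonicOnNhd.eq_zero_of_eq_add_memLp` run on mollifications, exactly as in the tree's
annihilator lemma `IsWeaklyDivFree.ae_eq_zero_of_add_memLp_of_forall_integral_inner_eq_zero`).

* `ae_eq_zero_of_add_memLp_of_forall_integral_laplacian_mul_eq_zero` — a weakly harmonic function
  in `L^p + L^q`, `1 < p, q < ∞`, vanishes a.e. (general finite-dimensional inner product space);
* `inner_fderiv_gradient_apply_bilin` — `⟪v, D(∇θ)(x) a⟫ = D²θ(x)(a, v)`;
* `integral_polarRieszPressure_mul_laplacian` — `∫ Π[w, u] Δθ = −∫ D²θ(w, u)` on `ℝ³`;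
* `IsClassicalDriftNSSolutionOn.integral_pressure_mul_laplacian` — the classical pressure solves the
  same weak Poisson equation at every interior time (divergence of the momentum equation:
  `div ∂ₜu = 0`, `div Δu = 0`, `∫⟪(w·∇)u, ∇θ⟫ = −∫ D²θ(w, u)` for `div w = 0`);
* `IsClassicalDriftNSSolutionOn.pressure_ae_eq_polarRieszPressure` — **the identification**
  `p(t) = Π[w(t), u(t)]` a.e., whenever `p(t) ∈ L²` and `u(t), w(t) ∈ L³` (`ℝ³`).

## Mathlib / tree search

Tree (all used): `rieszPressure`, `memLp_rieszPressure`, `integral_rieszPressure_mul_laplacian`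
(`RieszPressureL3`), `integrable_hessian_apply_of_memLp_three` (`RieszPressureLocality`),
`HarmonicOnNhd.eq_zero_of_eq_add_memLp`, `laplacian_convolution_lsmul`, `laplacian_comp_sub_left`
(`HelmholtzAnnihilator`), `divergence_deriv_time_eq_zero`, `divergence_laplacian_eq_zero`,
`divergence_gradient` (`PressurePoisson`), `integral_mul_divergence_add_eq_zero_left/right`,
`integral_inner_convect_add_eq_zero` (`WholeSpaceIBP`), `FunctionSpaces.ae_tendsto_normed_convolution`,
`FunctionSpaces.memLp_normed_convolution`, `FunctionSpaces.exists_contDiffBump_seq` (`Mollification`).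
`lean search 'polarRiesz|pressure_ae_eq_rieszPressure'`: only `pressure_ae_eq_rieszPressure_add_const`
(`PressureNormalisationL3`, the Navier–Stokes case `w = u` under decay hypotheses), not usable here.

## References

* J. Leray, Acta Math. 63 (1934), Ch. V §26 (5.1). [Leray1934]
* P. G. Lemarié-Rieusset, *The Navier–Stokes Problem in the 21st Century* (2016), Def. 6.9,
  Prop. 6.2, and the proof of Thm. 4.4 (pp. 56–57). [LemarieRieusset2016]
* T.-P. Tsai, Arch. Rational Mech. Anal. 143 (1998), Lemma 2.1. [Tsai1998]
* L. Caffarelli, R. Kohn, L. Nirenberg, Comm. Pure Appl. Math. 35 (1982), §2 p. 780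
  (`Δp = −∂ᵢ∂ⱼ(uᵢuⱼ)`) and Appendix. [CaffarelliKohnNirenberg1982]
-/

noncomputable section

open MeasureTheory TopologicalSpace Set Function Filter Topology InnerProductSpace
  ContinuousLinearMap Metric
open scoped RealInnerProductSpace ENNReal NNReal Convolution ContDiff Laplacian

namespace Literature.Analysis.FluidPDE

/-! ### Liouville: weakly harmonic functions in `L^p + L^q` vanish -/

section Liouville

variable {E : Type*} [NormedAddCommGroup E] [InnerProductSpace ℝ E] [FiniteDimensional ℝ E]
  [MeasurableSpace E] [BorelSpace E]

/-- **A weakly harmonic function in `L^p + L^q` vanishes a.e.** Let `1 < p, q < ∞`, `h₁ ∈ L^p(E)`,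
`h₂ ∈ L^q(E)` on a finite-dimensional real inner product space `E`, and suppose
`∫ Δθ · (h₁ + h₂) = 0` for every test function `θ` (`E ≠ {0}`). Then `h₁ + h₂ = 0` a.e. Proof as for the tree's
annihilator lemma (Lemarié-Rieusset 2016, proof of Thm. 4.4, pp. 56–57, run on mollifications): each
mollification `φₖ ⋆ (h₁ + h₂)` is smooth and harmonic (`Δ(φₖ ⋆ h) = ∫ Δφₖ(x − ·) h = 0`) and splits
as `φₖ ⋆ h₁ + φₖ ⋆ h₂ ∈ L^p + L^q`, hence vanishes by Liouville
(`HarmonicOnNhd.eq_zero_of_eq_add_memLp`); and `φₖ ⋆ (h₁ + h₂) → h₁ + h₂` a.e.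
[cite: LemarieRieusset2016, proof of Thm. 4.4 pp. 56–57] -/
theorem ae_eq_zero_of_add_memLp_of_forall_integral_laplacian_mul_eq_zero [Nontrivial E] {p q : ℝ≥0∞}
    (hp : 1 < p) (hp' : p < (⊤ : ℝ≥0∞)) (hq : 1 < q) (hq' : q < (⊤ : ℝ≥0∞)) {h₁ h₂ : E → ℝ}
    (hh₁ : MemLp h₁ p (volume : Measure E)) (hh₂ : MemLp h₂ q (volume : Measure E))
    (hharm : ∀ θ : E → ℝ, FunctionSpaces.IsTestFunctionOn (⊤ : Opens E) θ →
      ∫ x, (Δ θ) x * (h₁ x + h₂ x) = 0) :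
    (fun x => h₁ x + h₂ x) =ᵐ[volume] 0 := by
  have hp1 : 1 ≤ p := hp.le
  have hq1 : 1 ≤ q := hq.le
  set wa : E → ℝ := fun y => h₁ y + h₂ y with hwa_def
  have hwa₁l : LocallyIntegrable h₁ volume := hh₁.locallyIntegrable hp1
  have hwa₂l : LocallyIntegrable h₂ volume := hh₂.locallyIntegrable hq1
  have hwa_eq : wa = h₁ + h₂ := rfl
  have hwal : LocallyIntegrable wa volume := hwa₁l.add hwa₂l
  obtain ⟨φ, hφ0, hφ2⟩ := FunctionSpaces.exists_contDiffBump_seq (E := E)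
  -- each mollification `φₖ ⋆ wa` is a harmonic function in `L^p + L^q`, hence zero
  have hzero : ∀ (k : ℕ) (x : E), ((φ k).normed volume ⋆[lsmul ℝ ℝ, volume] wa) x = 0 := by
    intro k
    set ψ : E → ℝ := (φ k).normed volume with hψ_def
    have hψ : FunctionSpaces.IsTestFunctionOn (⊤ : Opens E) ψ :=
      FunctionSpaces.isTestFunctionOn_normed (φ k)
    have hψ2 : ContDiff ℝ 2 ψ := contDiff_infty.1 hψ.contDiff 2
    have hh2 : ContDiff ℝ 2 (ψ ⋆[lsmul ℝ ℝ, volume] wa) :=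
      hψ.hasCompactSupport.contDiff_convolution_left _ hψ2 hwal
    have hΔ : ∀ x, Δ (ψ ⋆[lsmul ℝ ℝ, volume] wa) x = 0 := by
      intro x
      rw [laplacian_convolution_lsmul hψ2 hψ.hasCompactSupport hwal x, convolution_def]
      simp only [ContinuousLinearMap.lsmul_apply, smul_eq_mul]
      have e := integral_sub_left_eq_self (fun t => (Δ ψ) t * wa (x - t)) volume x
      simp only [sub_sub_cancel] at e
      rw [← e]
      have hθ : FunctionSpaces.IsTestFunctionOn (⊤ : Opens E) (fun z => ψ (x - z)) :=
        hψ.comp_sub_left x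
      have key := hharm _ hθ
      simp_rw [laplacian_comp_sub_left hψ2 x] at key
      exact key
    have hharm' : HarmonicOnNhd (ψ ⋆[lsmul ℝ ℝ, volume] wa) univ := fun x _ =>
      ⟨hh2.contDiffAt, Eventually.of_forall fun y => hΔ y⟩
    -- the splitting `φₖ ⋆ wa = φₖ ⋆ h₁ + φₖ ⋆ h₂ ∈ L^p + L^q`
    have hsplit : ψ ⋆[lsmul ℝ ℝ, volume] wa =
        ψ ⋆[lsmul ℝ ℝ, volume] h₁ + ψ ⋆[lsmul ℝ ℝ, volume] h₂ := by
      funext x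
      rw [hwa_eq]
      exact (hψ.hasCompactSupport.convolutionExists_left _ hψ.contDiff.continuous hwa₁l x)
        |>.distrib_add
        (hψ.hasCompactSupport.convolutionExists_left _ hψ.contDiff.continuous hwa₂l x)
    have hm₁ : MemLp (ψ ⋆[lsmul ℝ ℝ, volume] h₁) p volume :=
      FunctionSpaces.memLp_normed_convolution (φ k) hh₁ hp1
    have hm₂ : MemLp (ψ ⋆[lsmul ℝ ℝ, volume] h₂) q volume :=
      FunctionSpaces.memLp_normed_convolution (φ k) hh₂ hq1
    have h0 := hharm'.eq_zero_of_eq_add_memLp hsplit hp hp' hq hq' hm₁ hm₂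
    exact fun x => congrFun h0 x
  have hlim := FunctionSpaces.ae_tendsto_normed_convolution hφ0 hφ2 hwal
  filter_upwards [hlim] with x hx
  simp_rw [hzero] at hx
  exact tendsto_nhds_unique hx tendsto_const_nhds

end Liouville

/-! ### Calculus of gradient test fields -/

section GradientTests

variable {E : Type*} [NormedAddCommGroup E] [InnerProductSpace ℝ E] [FiniteDimensional ℝ E]

omit [FiniteDimensional ℝ E] in
/-- **`⟪v, D(∇θ)(x) a⟫ = D²θ(x)(a, v)`** for `θ ∈ C²` [complete `E`]: the pairing `⟪u, (w·∇)∇θ⟫`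
against a gradient field is the Hessian bilinear form `Σᵢⱼ wᵢuⱼ∂ᵢ∂ⱼθ` (chain rule through the
Riesz isometry, as in the tree's `inner_fderiv_gradient_apply`, which is the case `a = v`). [folklore] -/
theorem inner_fderiv_gradient_apply_bilin [CompleteSpace E] {θ : E → ℝ} (hθ : ContDiff ℝ 2 θ)
    (x a v : E) : ⟪v, fderiv ℝ (gradient θ) x a⟫ = fderiv ℝ (fderiv ℝ θ) x a v := by
  set L : (E →L[ℝ] ℝ) →L[ℝ] E :=
    (InnerProductSpace.toDual ℝ E).symm.toContinuousLinearEquiv.toContinuousLinearMap with hL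
  have hLapp : ∀ w : E →L[ℝ] ℝ, L w = (InnerProductSpace.toDual ℝ E).symm w := fun w => rfl
  have hd : DifferentiableAt ℝ (fderiv ℝ θ) x :=
    ((hθ.fderiv_right (m := 1) le_rfl).differentiable one_ne_zero) x
  have h1 : gradient θ = fun y => L (fderiv ℝ θ y) := rfl
  have h2 : HasFDerivAt (fun y => L (fderiv ℝ θ y)) (L.comp (fderiv ℝ (fderiv ℝ θ) x)) x :=
    L.hasFDerivAt.comp x hd.hasFDerivAt
  rw [h1, h2.fderiv, ContinuousLinearMap.comp_apply, hLapp, real_inner_comm,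
    InnerProductSpace.toDual_symm_apply]

omit [FiniteDimensional ℝ E] in
/-- Symmetry of the Hessian of a `C²` function: `D²θ(x)(a, b) = D²θ(x)(b, a)`. [folklore] -/
theorem fderiv_fderiv_apply_symm {θ : E → ℝ} (hθ : ContDiff ℝ 2 θ) (x a b : E) :
    fderiv ℝ (fderiv ℝ θ) x a b = fderiv ℝ (fderiv ℝ θ) x b a := by
  have h22 : minSmoothness ℝ 2 ≤ (2 : ℕ∞ω) := by
    rw [minSmoothness_of_isRCLikeNormedField]
  exact (hθ.contDiffAt.isSymmSndFDerivAt h22).eq a b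

omit [FiniteDimensional ℝ E] in
/-- Polarisation of the Hessian quadratic form:
`D²θ(a+b, a+b) − D²θ(a−b, a−b) = 4 D²θ(a, b)`. [folklore] -/
theorem fderiv_fderiv_polarisation {θ : E → ℝ} (hθ : ContDiff ℝ 2 θ) (x a b : E) :
    fderiv ℝ (fderiv ℝ θ) x (a + b) (a + b) - fderiv ℝ (fderiv ℝ θ) x (a - b) (a - b) =
      4 * fderiv ℝ (fderiv ℝ θ) x a b := by
  have hs := fderiv_fderiv_apply_symm hθ x b a
  simp only [map_add, map_sub, add_apply, sub_apply]
  rw [hs]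
  ring

end GradientTests

/-! ### The Riesz pressure of a pair of `L³` fields on `ℝ³` -/

section Polar

-- nested operator types
set_option maxSynthPendingDepth 3 in
/-- **The weak Poisson equation of the pair pressure** `Π[w, u] = ¼ (Π[w + u] − Π[w − u])`
(polarisation of the tree's Riesz pressure `Π[v] = Σ ℛᵢℛⱼ(vᵢvⱼ)`): for `w, u ∈ L³(ℝ³)` and every
test function `θ`, `∫ Π[w, u] Δθ = −∫ D²θ(w, u)` (from `integral_rieszPressure_mul_laplacian` for
`w ± u` and the polarisation of the Hessian). [cite: LemarieRieusset2016, Def. 6.9 with Prop. 6.2] -/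
theorem integral_polarRieszPressure_mul_laplacian
    {w u : EuclideanSpace ℝ (Fin 3) → EuclideanSpace ℝ (Fin 3)} (hw : MemLp w 3 volume)
    (hu : MemLp u 3 volume) {θ : EuclideanSpace ℝ (Fin 3) → ℝ} (hθ : ContDiff ℝ (⊤ : ℕ∞) θ)
    (hθc : HasCompactSupport θ) :
    ∫ x, 4⁻¹ * (rieszPressure (w + u) x - rieszPressure (w - u) x) * (Δ θ) x =
      -∫ x, fderiv ℝ (fderiv ℝ θ) x (w x) (u x) := by
  have hθ2 : ContDiff ℝ 2 θ := contDiff_infty.1 hθ 2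
  have hp : MemLp (w + u) 3 volume := hw.add hu
  have hm : MemLp (w - u) 3 volume := hw.sub hu
  have ep := integral_rieszPressure_mul_laplacian hp hθ hθc
  have em := integral_rieszPressure_mul_laplacian hm hθ hθc
  -- integrability of the pairings
  have hΔc : Continuous (Δ θ) := continuous_laplacian hθ2
  have hΔs : HasCompactSupport (Δ θ) :=
    hθc.mono' fun x hx => by
      contrapose! hx
      simp [laplacian_eq_zero_of_notMem_tsupport hx]
  have hΔ3 : MemLp (Δ θ) 3 volume := hΔc.memLp_of_hasCompactSupport hΔs
  haveI : ENNReal.HolderTriple (3 / 2) 3 1 := by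
    have h23 : (2 : ℝ≥0∞) / 3 + 3⁻¹ = 1 := by
      rw [show (3 : ℝ≥0∞)⁻¹ = 1 / 3 by rw [one_div], ENNReal.div_add_div_same,
        show (2 : ℝ≥0∞) + 1 = 3 by norm_num]
      exact ENNReal.div_self (by norm_num) (by norm_num)
    constructor
    rw [ENNReal.inv_div (Or.inr (by norm_num)) (Or.inr (by norm_num)), inv_one, h23]
  have ip : Integrable (fun x => rieszPressure (w + u) x * (Δ θ) x) volume :=
    (memLp_rieszPressure hp).integrable_mul hΔ3
  have im : Integrable (fun x => rieszPressure (w - u) x * (Δ θ) x) volume :=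
    (memLp_rieszPressure hm).integrable_mul hΔ3
  have jp : Integrable (fun x => fderiv ℝ (fderiv ℝ θ) x ((w + u) x) ((w + u) x)) volume :=
    integrable_hessian_apply_of_memLp_three hp hθ hθc
  have jm : Integrable (fun x => fderiv ℝ (fderiv ℝ θ) x ((w - u) x) ((w - u) x)) volume :=
    integrable_hessian_apply_of_memLp_three hm hθ hθc
  -- polarisation on both sides
  have e1 : ∫ x, 4⁻¹ * (rieszPressure (w + u) x - rieszPressure (w - u) x) * (Δ θ) x =
      4⁻¹ * ((∫ x, rieszPressure (w + u) x * (Δ θ) x) - ∫ x, rieszPressure (w - u) x * (Δ θ) x) := by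
    rw [← integral_sub ip im, ← integral_const_mul]
    exact integral_congr_ae (Eventually.of_forall fun x => by ring)
  have e2 : ∫ x, fderiv ℝ (fderiv ℝ θ) x (w x) (u x) =
      4⁻¹ * ((∫ x, fderiv ℝ (fderiv ℝ θ) x ((w + u) x) ((w + u) x)) -
        ∫ x, fderiv ℝ (fderiv ℝ θ) x ((w - u) x) ((w - u) x)) := by
    rw [← integral_sub jp jm, ← integral_const_mul]
    refine integral_congr_ae (Eventually.of_forall fun x => ?_)
    simp only [Pi.add_apply, Pi.sub_apply]
    rw [fderiv_fderiv_polarisation hθ2 x (w x) (u x)]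
    ring
  rw [e1, e2, ep, em]
  ring

/-- The pair pressure of two `L³` fields is in `L^{3/2}(ℝ³)`. [folklore] -/
theorem memLp_polarRieszPressure {w u : EuclideanSpace ℝ (Fin 3) → EuclideanSpace ℝ (Fin 3)}
    (hw : MemLp w 3 volume) (hu : MemLp u 3 volume) :
    MemLp (fun x => 4⁻¹ * (rieszPressure (w + u) x - rieszPressure (w - u) x))
      (3 / 2 : ℝ≥0∞) volume :=
  ((memLp_rieszPressure (hw.add hu)).sub (memLp_rieszPressure (hw.sub hu))).const_mul 4⁻¹

end Polar

/-! ### The classical pressure of the drift system solves the weak Poisson equation -/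

section Classical

variable {E : Type*} [NormedAddCommGroup E] [InnerProductSpace ℝ E] [FiniteDimensional ℝ E]
  [MeasurableSpace E] [BorelSpace E]
variable {S : Set ℝ} {ν : ℝ} {w u : ℝ → E → E} {p : ℝ → E → ℝ}

/-- **The weak pressure Poisson equation of a classical drift solution.** For a classical solution
of `∂ₜu + (w·∇)u = νΔu − ∇p`, `div u = div w = 0` on the time set `S` and an interior time `t`,
`∫ p(t) Δθ = −∫ D²θ(w(t), u(t))` for every test function `θ`: pair `∇p = νΔu − ∂ₜu − (w·∇)u` with
`∇θ` and integrate by parts — `div ∂ₜu = 0` (`divergence_deriv_time_eq_zero`), `div Δu = 0`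
(`divergence_laplacian_eq_zero`) and `∫⟪(w·∇)u, ∇θ⟫ = −∫⟪u, (w·∇)∇θ⟫ = −∫ D²θ(w, u)` for
`div w = 0` (Caffarelli–Kohn–Nirenberg 1982, §2 p. 780: "`Δp = −∂ᵢ∂ⱼ(uᵢuⱼ)`", here for the drift
system of Leray 1934, (5.1)). [cite: CaffarelliKohnNirenberg1982, §2 p. 780] -/
theorem IsClassicalDriftNSSolutionOn.integral_pressure_mul_laplacian
    (h : IsClassicalDriftNSSolutionOn S ν w u p) {t : ℝ} (ht : t ∈ interior S)
    {θ : E → ℝ} (hθ : ContDiff ℝ (⊤ : ℕ∞) θ) (hθc : HasCompactSupport θ) :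
    ∫ x, p t x * (Δ θ) x = -∫ x, fderiv ℝ (fderiv ℝ θ) x (w t x) (u t x) := by
  -- restrict to the open set of interior times
  set S₀ := interior S with hS₀_def
  have hS₀ : IsOpen S₀ := isOpen_interior
  have h₀ : IsClassicalDriftNSSolutionOn S₀ ν w u p := h.mono interior_subset hS₀.uniqueDiffOn
  -- the two-sided time derivative and the regularity of all fields at time `t`
  set dtu : E → E := fun y => deriv (fun s => u s y) t with hdtu_def
  have hdt : ContDiff ℝ ∞ dtu := (h₀.smooth_velocity.isSmoothSpaceTimeOn_deriv hS₀).contDiff_slice ht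
  have hu : ContDiff ℝ ∞ (u t) := h₀.smooth_velocity.contDiff_slice ht
  have hw : ContDiff ℝ ∞ (w t) := h₀.smooth_drift.contDiff_slice ht
  have hp : ContDiff ℝ ∞ (p t) := h₀.smooth_pressure.contDiff_slice ht
  have hu1 : ContDiff ℝ 1 (u t) := contDiff_infty.1 hu 1
  have hu3 : ContDiff ℝ 3 (u t) := contDiff_infty.1 hu 3
  have hw1 : ContDiff ℝ 1 (w t) := contDiff_infty.1 hw 1
  have hp1 : ContDiff ℝ 1 (p t) := contDiff_infty.1 hp 1
  have hdt1 : ContDiff ℝ 1 dtu := contDiff_infty.1 hdt 1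
  have hθ1 : ContDiff ℝ 1 θ := contDiff_infty.1 hθ 1
  have hθ2 : ContDiff ℝ 2 θ := contDiff_infty.1 hθ 2
  have hθ3 : ContDiff ℝ 3 θ := contDiff_infty.1 hθ 3
  have hΔu1 : ContDiff ℝ 1 (Δ (u t)) :=
    contDiff_infty.1 ((h₀.smooth_velocity.laplacian hS₀.uniqueDiffOn).contDiff_slice ht) 1
  -- the gradient test field `∇θ`
  have hG1 : ContDiff ℝ 1 (gradient θ) :=
    (InnerProductSpace.toDual ℝ E).symm.contDiff.comp (hθ2.fderiv_right (m := 1) le_rfl)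
  have hGc : HasCompactSupport (gradient θ) := hasCompactSupport_gradient hθc
  -- the momentum equation solved for the pressure gradient
  have hgrad : ∀ y, gradient (p t) y = ν • (Δ (u t)) y - dtu y - convect (w t) (u t) y := by
    intro y
    have hm := h₀.momentum_timeDeriv hS₀ ht y
    rw [timeDeriv_apply] at hm
    change dtu y + convect (w t) (u t) y = ν • (Δ (u t)) y - gradient (p t) y at hm
    rw [← sub_eq_zero] at hm ⊢
    rw [← hm]
    abel
  -- (i) `∫ p Δθ = -∫ ⟪∇p, ∇θ⟫`
  have e1 : ∫ x, p t x * (Δ θ) x = -∫ x, ⟪gradient (p t) x, gradient θ x⟫ := by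
    have h1 := integral_mul_divergence_add_eq_zero_right hp1 hG1 hGc
    have h2 : ∫ x, p t x * VectorCalculus.divergence (gradient θ) x = ∫ x, p t x * (Δ θ) x :=
      integral_congr_ae (Eventually.of_forall fun x => by simp only [divergence_gradient hθ2 x])
    have h3 : ∫ x, ⟪gradient θ x, gradient (p t) x⟫ = ∫ x, ⟪gradient (p t) x, gradient θ x⟫ :=
      integral_congr_ae (Eventually.of_forall fun x => real_inner_comm _ _)
    rw [h2, h3] at h1
    linarith
  -- (ii) `∫ ⟪Δu, ∇θ⟫ = 0` and `∫ ⟪∂ₜu, ∇θ⟫ = 0` (divergence free)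
  have e2 : ∫ x, ⟪(Δ (u t)) x, gradient θ x⟫ = 0 := by
    have h1 := integral_mul_divergence_add_eq_zero_left hθ1 hΔu1 hθc
    have hz : ∫ x, θ x * VectorCalculus.divergence (Δ (u t)) x = 0 := by
      simp [divergence_laplacian_eq_zero hu3 (h₀.divFree t ht)]
    linarith
  have e3 : ∫ x, ⟪dtu x, gradient θ x⟫ = 0 := by
    have h1 := integral_mul_divergence_add_eq_zero_left hθ1 hdt1 hθc
    have hz : ∫ x, θ x * VectorCalculus.divergence dtu x = 0 := by
      simp [hdtu_def, divergence_deriv_time_eq_zero h₀.smooth_velocity hS₀ h₀.divFree ht]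
    linarith
  -- (iii) `∫ ⟪(w·∇)u, ∇θ⟫ = -∫ D²θ(w, u)`
  have e4 : ∫ x, ⟪convect (w t) (u t) x, gradient θ x⟫ =
      -∫ x, fderiv ℝ (fderiv ℝ θ) x (w t x) (u t x) := by
    have h1 := integral_inner_convect_add_eq_zero hw1 hu1 hG1 hGc
    have hz : ∫ x, VectorCalculus.divergence (w t) x * ⟪u t x, gradient θ x⟫ = 0 := by
      simp [h₀.divFree_drift t ht _]
    have h2 : ∫ x, ⟪u t x, convect (w t) (gradient θ) x⟫ =
        ∫ x, fderiv ℝ (fderiv ℝ θ) x (w t x) (u t x) :=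
      integral_congr_ae (Eventually.of_forall fun x => by
        show ⟪u t x, convect (w t) (gradient θ) x⟫ = _
        rw [convect_apply, inner_fderiv_gradient_apply_bilin hθ2])
    rw [h2] at h1
    linarith
  -- integrability of the three pieces of `⟪∇p, ∇θ⟫`
  have hGcont : Continuous (gradient θ) := hG1.continuous
  have iL : Integrable (fun x => ⟪(Δ (u t)) x, gradient θ x⟫) (volume : Measure E) :=
    integrable_inner_of_hasCompactSupport_right hΔu1.continuous hGcont hGc
  have iT : Integrable (fun x => ⟪dtu x, gradient θ x⟫) (volume : Measure E) :=
    integrable_inner_of_hasCompactSupport_right hdt1.continuous hGcont hGc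
  have iC : Integrable (fun x => ⟪convect (w t) (u t) x, gradient θ x⟫) (volume : Measure E) :=
    integrable_inner_of_hasCompactSupport_right
      ((hu1.continuous_fderiv one_ne_zero).clm_apply hw1.continuous) hGcont hGc
  have e5 : ∫ x, ⟪gradient (p t) x, gradient θ x⟫ =
      ν * (∫ x, ⟪(Δ (u t)) x, gradient θ x⟫) - (∫ x, ⟪dtu x, gradient θ x⟫) -
        ∫ x, ⟪convect (w t) (u t) x, gradient θ x⟫ := by
    have key : ∀ x, ⟪gradient (p t) x, gradient θ x⟫ =
        ν * ⟪(Δ (u t)) x, gradient θ x⟫ - ⟪dtu x, gradient θ x⟫ -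
          ⟪convect (w t) (u t) x, gradient θ x⟫ := fun x => by
      rw [hgrad x]
      simp only [inner_sub_left, inner_smul_left, RCLike.conj_to_real]
    have iL' : Integrable (fun x => ν * ⟪(Δ (u t)) x, gradient θ x⟫) (volume : Measure E) :=
      iL.const_mul ν
    have iLT : Integrable (fun x => ν * ⟪(Δ (u t)) x, gradient θ x⟫ - ⟪dtu x, gradient θ x⟫)
        (volume : Measure E) := iL'.sub iT
    rw [integral_congr_ae (Eventually.of_forall key), integral_sub iLT iC, integral_sub iL' iT,
      integral_const_mul]
  rw [e1, e5, e2, e3, e4]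
  ring

end Classical

/-! ### Identification with the pair Riesz pressure on `ℝ³` -/

section Identification

variable {S : Set ℝ} {ν : ℝ}
  {w u : ℝ → EuclideanSpace ℝ (Fin 3) → EuclideanSpace ℝ (Fin 3)}
  {p : ℝ → EuclideanSpace ℝ (Fin 3) → ℝ}

-- nested operator types
set_option maxSynthPendingDepth 3 in
/-- **The classical pressure of the drift system is the pair Riesz pressure.** Let `(w, u, p)` be a
classical solution of `∂ₜu + (w·∇)u = νΔu − ∇p`, `div u = div w = 0` on `ℝ³ × S`, `t` an interior time,
with `p(t) ∈ L²`, `u(t) ∈ L³`, `w(t) ∈ L³`. Then `p(t) = ¼ (Π[w(t) + u(t)] − Π[w(t) − u(t)])` a.e.: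
both sides solve `∫ q Δθ = −∫ D²θ(w(t), u(t))`
(`IsClassicalDriftNSSolutionOn.integral_pressure_mul_laplacian`,
`integral_polarRieszPressure_mul_laplacian`), and a weakly harmonic function in `L² + L^{3/2}`
vanishes (`ae_eq_zero_of_add_memLp_of_forall_integral_laplacian_mul_eq_zero`). For Leray's
regularised solutions this upgrades the Fourier-side bound `p_ε(t) ∈ L²` to the Calderón–Zygmund
bounds of the Riesz pressure. [cite: LemarieRieusset2016, Def. 6.9 with Prop. 6.2 and proof of Thm. 4.4 pp. 56–57] -/
theorem IsClassicalDriftNSSolutionOn.pressure_ae_eq_polarRieszPressure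
    (h : IsClassicalDriftNSSolutionOn S ν w u p) {t : ℝ} (ht : t ∈ interior S)
    (hp2 : MemLp (p t) 2 volume) (hu3 : MemLp (u t) 3 volume) (hw3 : MemLp (w t) 3 volume) :
    p t =ᵐ[volume] fun x => 4⁻¹ * (rieszPressure (w t + u t) x - rieszPressure (w t - u t) x) := by
  set Q : EuclideanSpace ℝ (Fin 3) → ℝ := fun x =>
    4⁻¹ * (rieszPressure (w t + u t) x - rieszPressure (w t - u t) x) with hQ
  have hQm : MemLp Q (3 / 2 : ℝ≥0∞) volume := memLp_polarRieszPressure hw3 hu3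
  have hQn : MemLp (fun x => -Q x) (3 / 2 : ℝ≥0∞) volume := hQm.neg
  have h32 : (1 : ℝ≥0∞) < 3 / 2 := by
    rw [ENNReal.lt_div_iff_mul_lt (Or.inl (by norm_num)) (Or.inl (by norm_num)), one_mul]
    exact_mod_cast (by norm_num : (2 : ℕ) < 3)
  have h32' : (3 / 2 : ℝ≥0∞) < ⊤ := ENNReal.div_lt_top ENNReal.ofNat_ne_top two_ne_zero
  have hharm : ∀ θ : EuclideanSpace ℝ (Fin 3) → ℝ,
      FunctionSpaces.IsTestFunctionOn (⊤ : Opens (EuclideanSpace ℝ (Fin 3))) θ →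
      ∫ x, (Δ θ) x * (p t x + -Q x) = 0 := by
    intro θ hθ
    have hθ2 : ContDiff ℝ 2 θ := contDiff_infty.1 hθ.contDiff 2
    have e1 := h.integral_pressure_mul_laplacian ht hθ.contDiff hθ.hasCompactSupport
    have e2 := integral_polarRieszPressure_mul_laplacian hw3 hu3 hθ.contDiff hθ.hasCompactSupport
    -- integrability of both pairings with `Δθ ∈ L³ ∩ L²`
    have hΔc : Continuous (Δ θ) := continuous_laplacian hθ2
    have hΔs : HasCompactSupport (Δ θ) :=
      hθ.hasCompactSupport.mono' fun x hx => by
        contrapose! hx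
        simp [laplacian_eq_zero_of_notMem_tsupport hx]
    have hΔ3 : MemLp (Δ θ) 3 volume := hΔc.memLp_of_hasCompactSupport hΔs
    have hΔ2 : MemLp (Δ θ) 2 volume := hΔc.memLp_of_hasCompactSupport hΔs
    haveI : ENNReal.HolderTriple (3 / 2) 3 1 := by
      have h23 : (2 : ℝ≥0∞) / 3 + 3⁻¹ = 1 := by
        rw [show (3 : ℝ≥0∞)⁻¹ = 1 / 3 by rw [one_div], ENNReal.div_add_div_same,
          show (2 : ℝ≥0∞) + 1 = 3 by norm_num]
        exact ENNReal.div_self (by norm_num) (by norm_num)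
      constructor
      rw [ENNReal.inv_div (Or.inr (by norm_num)) (Or.inr (by norm_num)), inv_one, h23]
    have iP : Integrable (fun x => p t x * (Δ θ) x) volume := hp2.integrable_mul hΔ2
    have iQ : Integrable (fun x => Q x * (Δ θ) x) volume := hQm.integrable_mul hΔ3
    have e3 : ∫ x, (Δ θ) x * (p t x + -Q x) = (∫ x, p t x * (Δ θ) x) - ∫ x, Q x * (Δ θ) x := by
      rw [← integral_sub iP iQ]
      exact integral_congr_ae (Eventually.of_forall fun x => by ring)
    rw [e3, e1, e2]
    ring
  have h0 := ae_eq_zero_of_add_memLp_of_forall_integral_laplacian_mul_eq_zero ENNReal.one_lt_two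
    ENNReal.ofNat_lt_top h32 h32' hp2 hQn hharm
  filter_upwards [h0] with x hx
  have hx' : p t x + -Q x = 0 := hx
  linarith

end Identification

end Literature.Analysis.FluidPDE

end
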